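import Summits.BirchSwinnertonDyer.BirchSwinnertonDyer.Theorems.QuadraticBranchSignedControlPlusEtaNonsurjTamagawaDichotomy
import HarnessLib

/-!
# Route `QuadraticBranchSignedControl` (rung K8, cell `bsd-potss`), residual crux
# `PlusEtaMainConjectureNonsurj` (stmt-BirchSwinnertonDyer-19606): the TAMAGAWA ROWS of the rank-`0`
# sub-cut — `X⁺(V/K_∞)^η ≠ 0` there, and a DICHOTOMY: `μ(X⁺(V/K_∞)^η) = 0` OR `Char(X⁺(V/K_∞)^η) = (p)`
# exactly — file 2 of 2: the `η`-side and the reading under the crux (seat `bsd-potss-k8eta-c2` g3)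

WHAT. Skeleton v3 of crux 19606 (planner g18) cuts its rank-`0` rows through `stub_etaMC_r0_mu`
(`μ(X⁺(V/K_∞)^η) = 0` in Greenberg–Vatsal's reading: every characteristic generator of every `η`-signed
plus dual datum has unit content). Below `5·10⁵` it has open content on exactly 7 rows (78300bh1,
159300l1, 162675n1, 404325f1, 164700i1, 164700n1, 417600fp1 at `p = 5`): the rows whose additive partner
`W` (`C • W^{(p*)} = V`) has `ord_p(#Sel_{p^∞}(W/ℚ)·Tam(W)) = 1` (seat g2's census; `μ ≤ 1` there by
`EtaMuBound.eta_le_of_C_pow_dvd_charGenerator`). THIS FILE pins the structure of those rows: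

* file 1 (`…PlusEtaNonsurjTamagawaDichotomy.lean`): the algebra in `Λ` (`v_p(g(0)) ≤ 1 ⟹ p ∤ g` OR
  `(g) = (p)`) and the `W`-side dichotomy / exactness for the plus dual data of `Sel⁺(W/ℚ_∞)`.
* §2 (`η`-side, through ctrl g4's (D5⁺)⁻¹): the same for every `η`-signed plus dual datum of `V` over an
  abstract `ℚ(μ_p)` — **on the Tamagawa rows `X⁺(V/K_∞)^η ≠ 0` and either `μ(X⁺(V/K_∞)^η) = 0` or
  `Char(X⁺(V/K_∞)^η) = (p)`** (then, granted Kitajima–Otsuki, `X⁺(V/K_∞)^η ≅ 𝔽_p⟦T⟧` up to the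
  structure theorem — not formalised here); so `stub_etaMC_r0_mu` holds at such a pair as soon as NO
  `η`-datum has characteristic ideal `(p)` (`eta_hasUnitContent_of_forall_charIdeal_ne_span_C`).
* §3 (reading under the crux): if (C1⁺_η) holds at a datum with `Char = (Lη)`, then on such a row
  `Lη ∉ Λˣ` and `p ∤ Lη` OR `(Lη) = (p)`: Kobayashi's conjecture PREDICTS for the analytic function
  `μ(L_p⁺(V,η,X)) = 0` (then `λ ≥ 1`; EVEN by the functional equation) or `L_p⁺(V,η,X) = p·unit` — a
  numerically decidable alternative (evidence: kit job j269184, PARI `ellpadiclambdamu`, seat census).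

HONEST FRAMING (cell `bsd-potss`, run/shared/lean/pub/bsd-potss/; FULL-BSD rank ≤ 1 programme,
tranche 1b, HUMAN RULING D-0036/D-0074): TOOL THEOREMS ONLY — no definition, no named Literature
fact minted, no Summits-side `def … : Prop`, no `sorry`, axioms standard. The dichotomy at `η` is
UNCONDITIONAL (per-row input `Sel_{p^∞}(W/ℚ)` finite displayed); the exactness statements are
CONDITIONAL on Poitou–Tate duality (`poitouTate_selmerStructure_duality_real ℚ`) and Kitajima–Otsuki
2018 Main Thm. 1.3 at `η` (named facts, hypothesis position); §3 takes (C1⁺_η) at the datum as a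
HYPOTHESIS. Nothing about (C1⁺_η) is
claimed; `stub_etaMC_r0_mu` is NOT proved (nor refuted) on any Tamagawa row; the crux 19606 stays OPEN;
nothing is booked; no label / mark / count moves. `--supports stmt-BirchSwinnertonDyer-19606`.

References: [GreenbergLNM1716] §3 Lemma 3.3 (pp. 86–88), §4 Thm. 4.1 and Lemma 4.2 (p. 102);
[GreenbergVatsal2000] p. 2 (1)–(2); [Kobayashi2003] §4 Even main conjecture and Thm. 4.1 (p. 8),
Thm. 9.3 with (9.33) (pp. 26–27); [KitajimaOtsuki2018] Main Thm. 1.3; [MilneADT2006] Ch. I Thm. 4.10;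
[Washington1997] §7.1 (units of `Λ`), §13.2; [MazurTateTeitelbaum1986Invent] §I.17 (functional equation).
-/

set_option autoImplicit false
set_option linter.dupNamespace false

noncomputable section

open scoped Classical

open CongruenceSubgroup Field Function NumberField IsDedekindDomain WeierstrassCurve
open Literature.NumberTheory.EllipticCurves
open Literature.NumberTheory.EllipticCurves.ModularForms
open Literature.NumberTheory.EllipticCurves.Rank1Residual
open Literature.NumberTheory.EllipticCurves.Rank1Residual.Typed
open Literature.NumberTheory.GaloisRepresentations
open Literature.NumberTheory.GaloisCohomology
open Literature.NumberTheory.EllipticCurves.IwasawaAlgebra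
open Literature.NumberTheory.EllipticCurves.IwasawaDual ZpExtension
open Literature.NumberTheory.EllipticCurves.GreenbergVatsal2000
open Summit.BirchSwinnertonDyer.Rank1Residual.X11b.Levels
open Summit.BirchSwinnertonDyer.Rank1Residual.X11b
open Summit.BirchSwinnertonDyer.Rank1Residual.Additive
open Summit.BirchSwinnertonDyer.Rank1Residual.Additive.SignedTwist
open scoped ContRepresentation
open Summit.BirchSwinnertonDyer.Rank1Residual.AdditivePotMult

namespace Summit.BirchSwinnertonDyer.BirchSwinnertonDyer.Theorems

namespace EtaTamagawaDichotomy

/-! ## §2 `η`-side: the `η`-signed plus dual data of `V` over an abstract `ℚ(μ_p)` ((D5⁺)⁻¹) -/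

section Eta

variable (W : WeierstrassCurve ℚ) [W.IsElliptic] [W.IsGloballyMinimal] (p : ℕ) [hp : Fact p.Prime]

/-- **DICHOTOMY AT `η` (unconditional): on a row with `ord_p #Sel_{p^∞}(W/ℚ) + ord_p Tam(W) ≤ 1`, every
`η`-signed plus dual datum `D'` of `V` (over an abstract `K₀ = ℚ(μ_p)`, `ηq` the quadratic character,
`κ` cyclotomic, `γ ∈ Gal(ℚ̄/K₀)` a topological generator) with `Char(D'.X) = (g)` has `p ∤ g`
(`μ(X⁺(V/K_∞)^η) = 0` in Greenberg–Vatsal's reading) OR `Char(X⁺(V/K_∞)^η) = (p)`.** `W` globally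
minimal, `p ≥ 5`, `V` a globally minimal model of `W^{(p*)}` good at `p` with `a_p(V) = 0`,
`Sel_{p^∞}(W/ℚ)` finite. ctrl g4's (D5⁺)⁻¹ `ConverseControl.exists_strictSignedSelmerDualData_one_of_eta`
(same characteristic ideal) + §1. No Poitou–Tate, no Kitajima–Otsuki, no Thm. 2.2/4.1, no image
hypothesis. [cite: Kobayashi2003, §4 p. 8 (X⁺(E/K_∞)^η), Thm. 9.3 with (9.33)]
[cite: GreenbergVatsal2000, p. 2 (2)] [cite: GreenbergLNM1716, §4 Lemma 4.2 (p. 102)] -/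
theorem eta_hasUnitContent_or_charIdeal_eq_span_C
    (V : WeierstrassCurve ℚ) [V.IsElliptic] [V.IsGloballyMinimal] (C : VariableChange ℚ)
    (hp5 : 5 ≤ p) (hCV : C • W.quadraticTwist ((-1) ^ (p / 2) * p) = V)
    (hgood : V.HasGoodReductionAtPrime p) (hap : V.frobeniusTrace p = 0)
    [Finite ↥(W.selmerGroupPInfty p)]
    (hle1 : padicValNat p (Nat.card ↥(W.selmerGroupPInfty p)) + padicValNat p W.tamagawaProduct ≤ 1)
    (K₀ : Type) [Field K₀] [NumberField K₀] [IsCyclotomicExtension {p} ℚ K₀]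
    [(galRange (K := ℚ) K₀).Normal] (ηq : absoluteGaloisGroup ℚ →* ℤˣ)
    (hηK : ∀ σ ∈ galRange (K := ℚ) K₀, ηq σ = 1) (hη1 : ηq ≠ 1)
    {κ : ZpExtension ℚ p} {γ : absoluteGaloisGroup ℚ} (hκ : κ.IsCyclotomic) (hγ : κ.IsTopGenerator γ)
    (hγK : γ ∈ galRange (K := ℚ) K₀) (D' : EtaSignedSelmerDualData V κ K₀ ℚ_[p] ηq γ 1)
    {g : IwasawaAlgebra p} (hg : D'.charIdeal = Ideal.span {g}) :
    HasUnitContent g ∨ D'.charIdeal = Ideal.span {PowerSeries.C (p : ℤ_[p])} := by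
  have hp2 : p ≠ 2 := by omega
  -- the dictionary data at the abstract `K₀ = ℚ(μ_p)`: `θ² = p*`, `ηq` = the sign character of `θ`
  obtain ⟨θ, hθ2⟩ := exists_sq_eq_pStar p K₀ hp2
  have hc : θ ^ 2 = algebraMap ℚ K₀ ((-1) ^ (p / 2) * p) := by
    rw [hθ2, map_mul, map_pow, map_neg, map_one, map_natCast]
  have hθ : θ ∉ Set.range (algebraMap ℚ K₀) := by
    rintro ⟨q, hq⟩
    apply forall_sq_ne_pStar p q
    apply (algebraMap ℚ K₀).injective
    rw [map_pow, hq, hc]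
  have hη := eta_eq_one_iff_smul_rootInClosure p K₀ hθ hc ηq hηK hη1
  have hDloc := localTowerHyp_padic p κ K₀ hκ
  have hκ₀ := kappa_surjOn_galRange_cyclotomic κ K₀
  have hcop := coprime_index_galRange_cyclotomic p K₀
  obtain ⟨D, -, -, hchar, -⟩ :=
    ConverseControl.exists_strictSignedSelmerDualData_one_of_eta W K₀ hθ hc p κ hCV ηq hη ℚ_[p] hDloc hκ₀
      hcop hγK D'
  rw [← hchar]
  exact hasUnitContent_or_charIdeal_eq_span_C κ W hp5 hκ C V hCV hgood hap hγ hle1 D (hchar.trans hg)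

/-- **EXACTNESS AT `η` (Poitou–Tate + Kitajima–Otsuki): on a row with `ord_p #Sel_{p^∞}(W/ℚ) +
ord_p Tam(W) = 1` — the TAMAGAWA rows of crux 19606's rank-`0` sub-cut — every `η`-signed plus dual
datum `D'` of `V` has `v_p(g(0)) = 1` for every generator `g` of `Char(D'.X)`, `Char(X⁺(V/K_∞)^η) ≠ Λ`
and `X⁺(V/K_∞)^η ≠ 0`.** Hypotheses as in `eta_hasUnitContent_or_charIdeal_eq_span_C`; named facts
`hPT` (Poitou–Tate duality) and `hKO` (Kitajima–Otsuki's Main Thm. 1.3 at `η`: no finite submodule —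
finiteness / torsion of `D'.X` being FREE on these rows from `Sel` finite, g2's Thm. 2.2η torsion half).
So on these rows `X⁺(V/K_∞)^η` is a NON-ZERO torsion module with `(μ, λ) = (0, ≥ 1)` or `Char = (p)`.
CONDITIONAL on `hPT`, `hKO`. [cite: Kobayashi2003, §4 p. 8, Thm. 2.2 (p. 5), Thm. 9.3 with (9.33)]
[cite: KitajimaOtsuki2018, Main Thm. 1.3] [cite: GreenbergLNM1716, §4 Thm. 4.1 and Lemma 4.2 (p. 102)]
[cite: MilneADT2006, Ch. I Thm. 4.10] -/
theorem eta_valuation_charGenerator_eq_one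
    (hPT : poitouTate_selmerStructure_duality_real ℚ)
    (hKO : KitajimaOtsuki2018.mainThm13_etaSignedSelmerDual_noFiniteSubmodule)
    (V : WeierstrassCurve ℚ) [V.IsElliptic] [V.IsGloballyMinimal] (C : VariableChange ℚ)
    (hp5 : 5 ≤ p) (hCV : C • W.quadraticTwist ((-1) ^ (p / 2) * p) = V)
    (hgood : V.HasGoodReductionAtPrime p) (hap : V.frobeniusTrace p = 0)
    [Finite ↥(W.selmerGroupPInfty p)]
    (heq1 : padicValNat p (Nat.card ↥(W.selmerGroupPInfty p)) + padicValNat p W.tamagawaProduct = 1)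
    (K₀ : Type) [Field K₀] [NumberField K₀] [IsCyclotomicExtension {p} ℚ K₀]
    [(galRange (K := ℚ) K₀).Normal] (ηq : absoluteGaloisGroup ℚ →* ℤˣ)
    (hηK : ∀ σ ∈ galRange (K := ℚ) K₀, ηq σ = 1) (hη1 : ηq ≠ 1)
    {κ : ZpExtension ℚ p} {γ : absoluteGaloisGroup ℚ} (hκ : κ.IsCyclotomic) (hγ : κ.IsTopGenerator γ)
    (hγK : γ ∈ galRange (K := ℚ) K₀) (D' : EtaSignedSelmerDualData V κ K₀ ℚ_[p] ηq γ 1)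
    {g : IwasawaAlgebra p} (hg : D'.charIdeal = Ideal.span {g}) :
    ((PowerSeries.constantCoeff g : ℤ_[p]) : ℚ_[p]).valuation = 1 ∧ ¬ IsUnit g ∧
      D'.charIdeal ≠ ⊤ ∧ Nontrivial D'.X := by
  have hp2 : p ≠ 2 := by omega
  obtain ⟨θ, hθ2⟩ := exists_sq_eq_pStar p K₀ hp2
  have hc : θ ^ 2 = algebraMap ℚ K₀ ((-1) ^ (p / 2) * p) := by
    rw [hθ2, map_mul, map_pow, map_neg, map_one, map_natCast]
  have hθ : θ ∉ Set.range (algebraMap ℚ K₀) := by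
    rintro ⟨q, hq⟩
    apply forall_sq_ne_pStar p q
    apply (algebraMap ℚ K₀).injective
    rw [map_pow, hq, hc]
  have hη := eta_eq_one_iff_smul_rootInClosure p K₀ hθ hc ηq hηK hη1
  have hDloc := localTowerHyp_padic p κ K₀ hκ
  have hκ₀ := kappa_surjOn_galRange_cyclotomic κ K₀
  have hcop := coprime_index_galRange_cyclotomic p K₀
  obtain ⟨D, hfin, htor, hchar, hnf⟩ :=
    ConverseControl.exists_strictSignedSelmerDualData_one_of_eta W K₀ hθ hc p κ hCV ηq hη ℚ_[p] hDloc hκ₀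
      hcop hγK D'
  -- finiteness / torsion of `D` (hence of `D'`) are free on a rank-0 row; no finite submodule is `hKO` on `D'`
  obtain ⟨hfgD, htorD, -⟩ :=
    EtaBottomLayer.isTorsion_and_constantCoeff_ne_zero_of_finite_selmer κ W hp2 hκ C V hCV hgood hap hγ D
  have hfin' : Module.Finite (IwasawaAlgebra p) D'.X := hfin.mp hfgD
  have htor' : Module.IsTorsion (IwasawaAlgebra p) D'.X := htor.mp htorD
  have hnf' : ∀ M : Submodule (IwasawaAlgebra p) D'.X, Finite M → M = ⊥ :=
    hKO p K₀ ηq hηK V hp2 hgood hap κ γ hκ hγ hγK 1 D'.toLiterature hfin' htor'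
  have hnfD : ∀ N : Submodule (IwasawaAlgebra p) D.X, Finite N → N = ⊥ := hnf.mpr hnf'
  have hv := valuation_charGenerator_eq_one κ W hPT hp5 hκ C V hCV hgood hap hγ heq1 D hnfD (hchar.trans hg)
  have hne : D'.charIdeal ≠ ⊤ := by
    rw [hg]
    exact span_ne_top_of_valuation_constantCoeff_ne_zero (by rw [hv]; exact one_ne_zero)
  refine ⟨hv, not_isUnit_of_valuation_constantCoeff_ne_zero (by rw [hv]; exact one_ne_zero), hne, ?_⟩
  -- `X ≠ 0`: transported through the `W`-side datum (same characteristic ideal)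
  obtain ⟨-, hX⟩ := charIdeal_ne_top_and_nontrivial κ W hPT hp5 hκ C V hCV hgood hap hγ heq1 D hnfD
  by_contra hX'
  rw [not_nontrivial_iff_subsingleton] at hX'
  -- `D'.X` subsingleton ⟹ `Char(D'.X) = ⊤`
  apply hne
  unfold EtaSignedSelmerDualData.charIdeal Module.charIdeal
  rw [← Ideal.one_eq_top]
  exact finprod_mem_of_eqOn_one fun 𝔭 _ ↦ by
    rw [Module.lengthAt_eq_zero_of_subsingleton, ENat.toNat_zero, pow_zero]
    rfl

/-- **`stub_etaMC_r0_mu` at a Tamagawa pair ⟸ «no `η`-datum has characteristic ideal `(p)`».** On a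
row with `ord_p #Sel_{p^∞}(W/ℚ) + ord_p Tam(W) ≤ 1` (so in particular on the 7 Tamagawa-`5` rows of the
census), if NO `η`-signed plus dual datum of `V` has `Char = (p)`, then every characteristic generator
of every `η`-datum has unit content — verbatim the conclusion `EtaMuZeroAt V p` of skeleton v3's
`stub_etaMC_r0_mu` / the binder `hμ` of g2's `EtaMuSaturation.etaUpperIntegral_of_hasUnitContent`.
UNCONDITIONAL (beyond `Sel` finite); nothing booked. [cite: GreenbergVatsal2000, p. 2 (2)]
[cite: Kobayashi2003, §4 p. 8] -/
theorem eta_hasUnitContent_of_forall_charIdeal_ne_span_C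
    (V : WeierstrassCurve ℚ) [V.IsElliptic] [V.IsGloballyMinimal] (C : VariableChange ℚ)
    (hp5 : 5 ≤ p) (hCV : C • W.quadraticTwist ((-1) ^ (p / 2) * p) = V)
    (hgood : V.HasGoodReductionAtPrime p) (hap : V.frobeniusTrace p = 0)
    [Finite ↥(W.selmerGroupPInfty p)]
    (hle1 : padicValNat p (Nat.card ↥(W.selmerGroupPInfty p)) + padicValNat p W.tamagawaProduct ≤ 1)
    (hne : ∀ (K₀ : Type) [Field K₀] [NumberField K₀] [IsCyclotomicExtension {p} ℚ K₀]
        [(galRange (K := ℚ) K₀).Normal] (ηq : absoluteGaloisGroup ℚ →* ℤˣ),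
        (∀ σ ∈ galRange (K := ℚ) K₀, ηq σ = 1) → ηq ≠ 1 →
      ∀ (κ : ZpExtension ℚ p) (γ : absoluteGaloisGroup ℚ),
        κ.IsCyclotomic → κ.IsTopGenerator γ → γ ∈ galRange (K := ℚ) K₀ →
      ∀ (D : EtaSignedSelmerDualData V κ K₀ ℚ_[p] ηq γ 1),
        D.charIdeal ≠ Ideal.span {PowerSeries.C (p : ℤ_[p])}) :
    ∀ (K₀ : Type) [Field K₀] [NumberField K₀] [IsCyclotomicExtension {p} ℚ K₀]
        [(galRange (K := ℚ) K₀).Normal] (ηq : absoluteGaloisGroup ℚ →* ℤˣ),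
        (∀ σ ∈ galRange (K := ℚ) K₀, ηq σ = 1) → ηq ≠ 1 →
      ∀ (κ : ZpExtension ℚ p) (γ : absoluteGaloisGroup ℚ),
        κ.IsCyclotomic → κ.IsTopGenerator γ → γ ∈ galRange (K := ℚ) K₀ →
      ∀ (D : EtaSignedSelmerDualData V κ K₀ ℚ_[p] ηq γ 1) (g : IwasawaAlgebra p),
        D.charIdeal = Ideal.span {g} → HasUnitContent g := by
  intro K₀ _ _ _ _ ηq hηK hη1 κ γ hκ hγ hγK D' g hg
  rcases eta_hasUnitContent_or_charIdeal_eq_span_C W p V C hp5 hCV hgood hap hle1 K₀ ηq hηK hη1 hκ hγ hγK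
      D' hg with hu | hspan
  · exact hu
  · exact absurd hspan (hne K₀ ηq hηK hη1 κ γ hκ hγ hγK D')

/-- **The stub-shaped ∀-form on the binders of `stub_etaMC_r0_mu`** (`p ≥ 5`, `C • W^{(p*)} = V`, `V`
good with `a_p = 0`; the tower / `L(W,1)` binders of the stub are not needed and omitted): with
`Sel_{p^∞}(W/ℚ)` finite and `ord_p(#Sel·Tam) ≤ 1`, every `η`-datum has `μ = 0` OR `Char = (p)`.
UNCONDITIONAL. [cite: Kobayashi2003, §4 p. 8] [cite: GreenbergVatsal2000, p. 2 (2)] -/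
theorem etaMu_dichotomy_rows :
    ∀ (V : WeierstrassCurve ℚ) [V.IsElliptic] [V.IsGloballyMinimal] (W : WeierstrassCurve ℚ) [W.IsElliptic]
      [W.IsGloballyMinimal] (C : VariableChange ℚ) (p : ℕ) [Fact p.Prime],
      5 ≤ p → C • W.quadraticTwist ((-1) ^ (p / 2) * p) = V →
      V.HasGoodReductionAtPrime p → V.frobeniusTrace p = 0 →
      ∀ [Finite ↥(W.selmerGroupPInfty p)],
      padicValNat p (Nat.card ↥(W.selmerGroupPInfty p)) + padicValNat p W.tamagawaProduct ≤ 1 →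
      ∀ (K₀ : Type) [Field K₀] [NumberField K₀] [IsCyclotomicExtension {p} ℚ K₀]
          [(galRange (K := ℚ) K₀).Normal] (ηq : absoluteGaloisGroup ℚ →* ℤˣ),
          (∀ σ ∈ galRange (K := ℚ) K₀, ηq σ = 1) → ηq ≠ 1 →
        ∀ (κ : ZpExtension ℚ p) (γ : absoluteGaloisGroup ℚ),
          κ.IsCyclotomic → κ.IsTopGenerator γ → γ ∈ galRange (K := ℚ) K₀ →
        ∀ (D : EtaSignedSelmerDualData V κ K₀ ℚ_[p] ηq γ 1) (g : IwasawaAlgebra p),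
          D.charIdeal = Ideal.span {g} →
            HasUnitContent g ∨ D.charIdeal = Ideal.span {PowerSeries.C (p : ℤ_[p])} := by
  intro V _ _ W _ _ C p _ hp5 hCV hgood hap _ hle1 K₀ _ _ _ _ ηq hηK hη1 κ γ hκ hγ hγK D g hg
  exact eta_hasUnitContent_or_charIdeal_eq_span_C W p V C hp5 hCV hgood hap hle1 K₀ ηq hηK hη1 hκ hγ hγK D hg

end Eta

/-! ## §3 Reading under the crux: what (C1⁺_η) predicts for `L_p⁺(V,η,X)` on a Tamagawa row -/

section Reading

variable (W : WeierstrassCurve ℚ) [W.IsElliptic] [W.IsGloballyMinimal] (p : ℕ) [hp : Fact p.Prime]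

/-- **Kobayashi's conjecture, read on a Tamagawa row.** If an `η`-datum `D'` of `V` satisfies the
conclusion of (C1⁺_η) with the plus `p`-adic `L`-function `Lη` — `Char(D'.X) = (Lη)` — on a row with
`ord_p #Sel_{p^∞}(W/ℚ) + ord_p Tam(W) = 1`, then (granted `hPT`, `hKO`) **`v_p(Lη(0)) = 1`, `Lη ∉ Λˣ`,
and `p ∤ Lη` (analytic `μ = 0`, hence `λ ≥ 1`) OR `(Lη) = (p)` (analytic `μ = 1`, `λ = 0`)** — the
crux's falsifiable prediction for the modular-symbol invariants of `L_p⁺(V,η,X)` on these rows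
(seat census: PARI `ellpadiclambdamu`, kit j269184). CONDITIONAL; nothing booked; (C1⁺_η) is a
HYPOTHESIS here. [cite: Kobayashi2003, §4 Even main conjecture (p. 8)] [cite: GreenbergVatsal2000, p. 2 (2)]
[cite: MazurTateTeitelbaum1986Invent, §I.17] -/
theorem mc_reading_tamagawaRow
    (hPT : poitouTate_selmerStructure_duality_real ℚ)
    (hKO : KitajimaOtsuki2018.mainThm13_etaSignedSelmerDual_noFiniteSubmodule)
    (V : WeierstrassCurve ℚ) [V.IsElliptic] [V.IsGloballyMinimal] (C : VariableChange ℚ)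
    (hp5 : 5 ≤ p) (hCV : C • W.quadraticTwist ((-1) ^ (p / 2) * p) = V)
    (hgood : V.HasGoodReductionAtPrime p) (hap : V.frobeniusTrace p = 0)
    [Finite ↥(W.selmerGroupPInfty p)]
    (heq1 : padicValNat p (Nat.card ↥(W.selmerGroupPInfty p)) + padicValNat p W.tamagawaProduct = 1)
    (K₀ : Type) [Field K₀] [NumberField K₀] [IsCyclotomicExtension {p} ℚ K₀]
    [(galRange (K := ℚ) K₀).Normal] (ηq : absoluteGaloisGroup ℚ →* ℤˣ)
    (hηK : ∀ σ ∈ galRange (K := ℚ) K₀, ηq σ = 1) (hη1 : ηq ≠ 1)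
    {κ : ZpExtension ℚ p} {γ : absoluteGaloisGroup ℚ} (hκ : κ.IsCyclotomic) (hγ : κ.IsTopGenerator γ)
    (hγK : γ ∈ galRange (K := ℚ) K₀) (D' : EtaSignedSelmerDualData V κ K₀ ℚ_[p] ηq γ 1)
    {Lη : IwasawaAlgebra p} (hMC : D'.charIdeal = Ideal.span {Lη}) :
    ((PowerSeries.constantCoeff Lη : ℤ_[p]) : ℚ_[p]).valuation = 1 ∧ ¬ IsUnit Lη ∧
      (HasUnitContent Lη ∨
        Ideal.span ({Lη} : Set (IwasawaAlgebra p)) = Ideal.span {PowerSeries.C (p : ℤ_[p])}) := by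
  obtain ⟨hv, hnu, -, -⟩ := eta_valuation_charGenerator_eq_one W p hPT hKO V C hp5 hCV hgood hap heq1 K₀ ηq
    hηK hη1 hκ hγ hγK D' hMC
  refine ⟨hv, hnu, ?_⟩
  rw [← hMC]
  exact eta_hasUnitContent_or_charIdeal_eq_span_C W p V C hp5 hCV hgood hap heq1.le K₀ ηq hηK hη1 hκ hγ hγK
    D' hMC

end Reading

end EtaTamagawaDichotomy

end Summit.BirchSwinnertonDyer.BirchSwinnertonDyer.Theorems

end
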